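import Literature.Barriers.Parity.SiegelZeroQuadraticPolynomialsInputs
import Literature.Barriers.Parity.SiegelZeroQuadraticPolynomialsTools
import Literature.Barriers.Parity.BrunTitchmarshSiegelZero
import Literature.NumberTheory.LFunctions.ExceptionalZeroLOneBound
import Literature.NumberTheory.LFunctions.SiegelExceptionalZeroBound
import Literature.NumberTheory.LFunctions.PrimitiveQuadraticCharacter
import Literature.NumberTheory.Sieve.RealCharacterSplitPrimesSieve
import HarnessLib

/-!
# Proof of `GranvilleMollin2000_eq5_5'` (the exceptional-prime sparsity estimate of
# *Rabinowitsch revisited*, §5C, display before (5.5))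

Topic `Literature/Barriers/Parity`, sibling of `SiegelZeroQuadraticPolynomialsInputs.lean`, which
vendors Granville–Mollin, *Rabinowitsch revisited*, Acta Arith. 96 (2000), §5C:
"If `d^η > x ≥ d^C` then by (3.3) and (3.2) … `∑_{p ≤ x} (1 + (d/p)) log p ≪ x log x / log(d^η)`"
as the named fact `Literature.Barriers.Parity.GranvilleMollin2000_eq5_5'` (for the family
`f_d = x² + x + (1−d)/4`, `ω_{f_d}(p) = 1 + (d/p)`). This file DISCHARGES it:
`GranvilleMollin2000_eq5_5'_holds`.

The printed proof rests on the explicit formula with the Deuring–Heilbronn phenomenon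
((3.1)–(3.3): Davenport §19 and Bombieri's log-free zero-density estimate), which is not available
in Mathlib. We prove the displayed inequality by the elementary route recorded in the docstring of
the Inputs file, all of whose steps are theorems of this tree:

1. `ω_{f_d}(p) = 1 + χ(p)` with `χ` the primitive quadratic character mod `q = |d|`
   (`polyRootCountMod_rabinowitschPoly`, `PrimitiveQuadratic.apply_natCast_eq_jacobiSym`).
2. **Siegel** (`Siegel.exists_one_sub_realZero_ge`, Montgomery–Vaughan Cor. 11.15, proved in the
   tree): the zero `β = 1 − 1/(η log q)` has `1 − β ≥ C₀ q^{-1/4}`, so `η log q ≤ q^{1/4}/C₀`.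
3. **`L(1,χ)` at the scale of the zero** (`RealChar.re_LFunction_one_le_prod_of_zero`, with
   `N = q⁴`, `⌊√N⌋ = q²`): `L(1,χ) ≤ (η log q)⁻¹ ∏_{p ≤ q⁴} ((1−1/p)(1−χ(p)/p))⁻¹ + 10/q`, whence, by the
   dimension-`2` property of the density `1 − g(p) = (1−1/p)(1−χ(p)/p)`
   (`hasSieveDimension_charDivisorDensity`), for `z = q^{1/10}`:
   `L(1,χ) ∏_{p<z} (1−1/p)(1−χ(p)/p) ≤ K₁/(η log q)` (`exists_LOne_mul_prod_le`).
4. **Upper-bound sieve** on `r = χ ∗ 1` (`Sieve.sum_primes_one_add_reChar_le`, the tree's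
   Fundamental Lemma): `∑_{z ≤ p ≤ x} (1 + χ(p)) ≤ (1 + C₂) x L(1,χ) ∏_{p<z}(…) + 5 q √x z³`.
5. Assembly: `∑_{p ≤ x} ω(p) log p ≤ log x (4z + ∑_{z ≤ p ≤ x}(1 + χ(p))) ≤ K x log x/(η log q)`
   for `x ≥ q^C`, `C > 9` (the upper constraint `x < q^η` of the source is not needed).

## References

* A. Granville, R. A. Mollin, *Rabinowitsch revisited*, Acta Arith. 96 (2000), 139–153, §5C.
  [GranvilleMollin2000]
* H. L. Montgomery, R. C. Vaughan, *Multiplicative Number Theory I*, CUP (2007), Cor. 11.15.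
  [MontgomeryVaughan2007]
-/

noncomputable section

open Finset Real
open Literature.NumberTheory.Sieve Literature.NumberTheory.LFunctions
open Literature.NumberTheory.LFunctions.RealChar Literature.NumberTheory.LFunctions.DirichletAbel

namespace Literature.Barriers.Parity

/-! ### `ω_{f_d}(p) = 1 + χ(p)` -/

/-- For a negative fundamental `d ≡ 1 (mod 4)` and `q = |d|`: `d = −q`, `q ≡ 3 (mod 4)`, `q` is
odd and squarefree. [folklore] -/
theorem negFundOne_facts {d : ℤ} (hd : IsNegFundOne d) {q : ℕ} (hqd : (q : ℤ) = |d|) :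
    d = -(q : ℤ) ∧ q % 4 = 3 ∧ Odd q ∧ Squarefree q := by
  obtain ⟨hneg, hsq, h4⟩ := hd
  have hdq : d = -(q : ℤ) := by rw [hqd, abs_of_neg hneg]; ring
  have hq4 : q % 4 = 3 := by omega
  refine ⟨hdq, hq4, Nat.odd_iff.mpr (by omega), ?_⟩
  have : d.natAbs = q := by rw [hdq]; simp
  rw [← this]
  exact Int.squarefree_natAbs.mpr hsq

/-- **`ω_{f_d}(p) = 1 + χ(p)`** for every prime `p`, where `χ` is the primitive quadratic character
mod `q = |d|` (the Jacobi symbol `(·/q)`, i.e. the Kronecker symbol `(d/·)`; Granville–Mollin (5.1)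
with `a = 1`). [cite: GranvilleMollin2000, §5 (5.1)] -/
theorem polyRootCountMod_eq_one_add_reChar {d : ℤ} (hd : IsNegFundOne d) {q : ℕ} [NeZero q]
    (hqd : (q : ℤ) = |d|) (χ : DirichletCharacter ℂ q) (hprim : χ.IsPrimitive)
    (hquad : χ.IsQuadratic) {p : ℕ} (hp : p.Prime) :
    (Literature.NumberTheory.Sieve.polyRootCountMod ![rabinowitschPoly d] p : ℝ) = 1 + reChar χ p := by
  obtain ⟨hdq, hq4, hodd, hsq⟩ := negFundOne_facts hd hqd
  have h1 := polyRootCountMod_rabinowitschPoly hdq hq4 hp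
  have h2 := PrimitiveQuadratic.apply_natCast_eq_jacobiSym hodd hsq χ hprim hquad p
  have h3 : reChar χ p = (jacobiSym p q : ℝ) := by
    rw [reChar_apply χ hp.ne_zero, h2, Complex.intCast_re]
  have h4 : ((Literature.NumberTheory.Sieve.polyRootCountMod ![rabinowitschPoly d] p : ℤ) : ℝ) =
      ((1 + jacobiSym p q : ℤ) : ℝ) := by rw [h1]
  push_cast at h4
  rw [h4, h3]

/-- `ω_{f_d}(p) ≤ 2`, as a real number. [folklore] -/
theorem polyRootCountMod_real_le_two {d : ℤ} (hd : IsNegFundOne d) {q : ℕ} (hqd : (q : ℤ) = |d|)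
    {p : ℕ} (hp : p.Prime) :
    (Literature.NumberTheory.Sieve.polyRootCountMod ![rabinowitschPoly d] p : ℝ) ≤ 2 := by
  obtain ⟨hdq, hq4, -, -⟩ := negFundOne_facts hd hqd
  exact_mod_cast polyRootCountMod_rabinowitschPoly_le_two hdq hq4 hp

/-! ### Elementary numerics -/

/-- `q ≥ 1024 ⟹ q^{1/10} ≥ 2`. [folklore] -/
theorem two_le_rpow_tenth {q : ℝ} (hq : 1024 ≤ q) : 2 ≤ q ^ (1 / 10 : ℝ) := by
  have h : (2 : ℝ) = (1024 : ℝ) ^ (1 / 10 : ℝ) := by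
    rw [show (1024 : ℝ) = 2 ^ (10 : ℝ) by norm_num, ← Real.rpow_mul (by norm_num)]
    norm_num
  rw [h]
  exact Real.rpow_le_rpow (by norm_num) hq (by norm_num)

/-- `V(S) = ∏_{p ∈ S} (1 − 1/p)(1 − χ(p)/p) ∈ [0, 1]` over any set of primes (quadratic `χ`);
each factor is `1 − g(p) ∈ (0, 1]`. [folklore] -/
theorem prod_one_sub_mul_nonneg_le_one {q : ℕ} (χ : DirichletCharacter ℂ q) (hq : χ ^ 2 = 1)
    (S : Finset ℕ) (hS : ∀ p ∈ S, p.Prime) :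
    0 ≤ ∏ p ∈ S, (1 - (p : ℝ)⁻¹) * (1 - reChar χ p / p) ∧
      ∏ p ∈ S, (1 - (p : ℝ)⁻¹) * (1 - reChar χ p / p) ≤ 1 ∧
        0 < ∏ p ∈ S, (1 - (p : ℝ)⁻¹) * (1 - reChar χ p / p) := by
  have hfac : ∀ p ∈ S, 0 < (1 - (p : ℝ)⁻¹) * (1 - reChar χ p / p) ∧
      (1 - (p : ℝ)⁻¹) * (1 - reChar χ p / p) ≤ 1 := by
    intro p hp
    have h := one_sub_charDivisorDensity_prime χ hq (hS p hp)
    have hb := Literature.NumberTheory.Sieve.charDivisorDensity_prime_bounds χ hq (hS p hp)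
    rw [← h]
    exact ⟨by linarith [hb.2.1], by linarith [hb.1]⟩
  exact ⟨prod_nonneg fun p hp => (hfac p hp).1.le,
    prod_le_one (fun p hp => (hfac p hp).1.le) fun p hp => (hfac p hp).2,
    prod_pos fun p hp => (hfac p hp).1⟩

/-! ### The main term: `L(1, χ) ∏_{p < q^{1/10}} (1 − 1/p)(1 − χ(p)/p) ≪ 1/(η log q)` -/

/-- **Main-term estimate.** There is an absolute `K₁ > 0` such that for every `q ≥ 1024`, every
quadratic `χ ≠ χ₀` mod `q`, every `η ≥ 3` with `L(1 − 1/(η log q), χ) = 0`: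
`L(1, χ) · ∏_{p < q^{1/10}} (1 − 1/p)(1 − χ(p)/p) ≤ K₁/(η log q)`.
Proof: Siegel (`1 − β ≥ C₀ q^{-1/4}`), `re_LFunction_one_le_prod_of_zero` with `N = q⁴` (`⌊√N⌋ = q²`),
and `V(q^{1/10}) ≤ K (log(q⁴+1)/log q^{1/10})² V(q⁴ + 1)` (dimension `2` of the density of
`χ ∗ 1`), so that `V(z) ∏_{p ≤ q⁴}(…)⁻¹ ≤ 2500 K`.
[cite: GranvilleMollin2000, §5C (display before (5.5))] -/
theorem exists_LOne_mul_prod_le :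
    ∃ K₁ : ℝ, 0 < K₁ ∧ ∀ (q : ℕ) [NeZero q], (1024 : ℝ) ≤ q →
      ∀ χ : DirichletCharacter ℂ q, χ ≠ 1 → χ ^ 2 = 1 →
        ∀ η : ℝ, 3 ≤ η → χ.LFunction ((1 - 1 / (η * Real.log q) : ℝ) : ℂ) = 0 →
          (χ.LFunction 1).re *
              ∏ p ∈ Nat.primesBelow ⌈(q : ℝ) ^ (1 / 10 : ℝ)⌉₊, (1 - (p : ℝ)⁻¹) * (1 - reChar χ p / p) ≤
            K₁ / (η * Real.log q) := by
  obtain ⟨C₀, hC₀, hSiegel⟩ := Siegel.exists_one_sub_realZero_ge (ε := 1 / 4) (by norm_num)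
  set K : ℝ := 4 * Real.exp (17 + 12 / Real.log 2) with hK
  have hKpos : 0 < K := by positivity
  refine ⟨2500 * K + 10 / C₀, by positivity, ?_⟩
  intro q _ hq χ hχ hq2 η hη hzero
  -- basic quantities
  have hq0 : (0 : ℝ) < q := by linarith
  have hq1 : (1 : ℝ) ≤ q := by linarith
  have hlogq : 1 < Real.log q := by
    -- `log q > 1 ⟺ q > e` (as in `Literature.NumberTheory.Sieve.GreenTao2008.one_lt_log_of_three_le`)
    rw [Real.lt_log_iff_exp_lt hq0]
    have := Real.exp_one_lt_d9
    linarith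
  set L := Real.log q with hL
  have hL0 : 0 < L := by linarith
  have hη0 : 0 < η := by linarith
  have hηL : 0 < η * L := by positivity
  have hηL3 : 3 ≤ η * L := by nlinarith
  set β : ℝ := 1 - 1 / (η * L) with hβ
  have hdivle : 1 / (η * L) ≤ 1 / 3 := one_div_le_one_div_of_le (by norm_num) hηL3
  have hdivpos : 0 < 1 / (η * L) := one_div_pos.mpr hηL
  have hβ1 : β < 1 := by rw [hβ]; linarith
  have hβ0 : 0 < β := by rw [hβ]; linarith
  have h1β : 1 - β = 1 / (η * L) := by rw [hβ]; ring
  -- Siegel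
  have hS := hSiegel q χ hq2 hχ β hzero
  rw [h1β] at hS
  -- the `L(1, χ)` bound with `N = q⁴` (`⌊√N⌋ = q²`)
  have hN1 : 1 ≤ q ^ 4 := Nat.one_le_pow _ _ (NeZero.pos q)
  have hF3 := re_LFunction_one_le_prod_of_zero χ hχ hq2 hβ0 hβ1 hzero hN1
  have hsqrt4 : Nat.sqrt (q ^ 4) = q ^ 2 := by
    rw [show q ^ 4 = q ^ 2 * q ^ 2 by ring, Nat.sqrt_eq]
  rw [h1β, hsqrt4] at hF3
  push_cast at hF3
  have herr : 10 * (q : ℝ) / (q : ℝ) ^ 2 ≤ 10 / q := by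
    have e1 : 10 * (q : ℝ) / (q : ℝ) ^ 2 = 10 / q := by field_simp
    rw [e1]
  -- the density products
  set A := charDivisorSeq χ hq2 with hA
  have hdim : HasSieveDimension A.density 2 K := hasSieveDimension_charDivisorDensity χ hq2
  set z : ℝ := (q : ℝ) ^ (1 / 10 : ℝ) with hz
  have hz2 : 2 ≤ z := two_le_rpow_tenth hq
  set N : ℕ := q ^ 4 with hN
  have hqN : (q : ℝ) ≤ ((N + 1 : ℕ) : ℝ) := by
    push_cast [hN]
    nlinarith [pow_le_pow_right₀ hq1 (show 1 ≤ 4 by norm_num)]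
  have hzq : z ≤ q := by
    rw [hz]
    calc (q : ℝ) ^ (1 / 10 : ℝ) ≤ (q : ℝ) ^ (1 : ℝ) := Real.rpow_le_rpow_of_exponent_le hq1 (by norm_num)
      _ = q := Real.rpow_one _
  have hzN : z ≤ ((N + 1 : ℕ) : ℝ) := hzq.trans hqN
  have hVV := SieveSequence.densityProduct_le_of_dim (A := A) hdim hz2 hzN
  rw [show A.densityProduct (primesProdBelow z) =
      ∏ p ∈ Nat.primesBelow ⌈z⌉₊, (1 - (p : ℝ)⁻¹) * (1 - reChar χ p / p) from
        charDivisorSeq_densityProduct χ hq2 z,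
    show A.densityProduct (primesProdBelow ((N + 1 : ℕ) : ℝ)) =
      ∏ p ∈ Nat.primesBelow (N + 1), (1 - (p : ℝ)⁻¹) * (1 - reChar χ p / p) by
        rw [charDivisorSeq_densityProduct χ hq2, Nat.ceil_natCast]] at hVV
  set Vz := ∏ p ∈ Nat.primesBelow ⌈z⌉₊, (1 - (p : ℝ)⁻¹) * (1 - reChar χ p / p) with hVz
  set W := ∏ p ∈ Nat.primesBelow (N + 1), (1 - (p : ℝ)⁻¹) * (1 - reChar χ p / p) with hW
  have hP : ∏ p ∈ Nat.primesBelow (N + 1), ((1 - (p : ℝ)⁻¹) * (1 - reChar χ p / p))⁻¹ = W⁻¹ := by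
    rw [hW, Finset.prod_inv_distrib]
  rw [hP] at hF3
  have hW3 := prod_one_sub_mul_nonneg_le_one χ hq2 (Nat.primesBelow (N + 1))
    (fun p hp => Nat.prime_of_mem_primesBelow hp)
  have hW0 : 0 < W := hW3.2.2
  have hVz3 := prod_one_sub_mul_nonneg_le_one χ hq2 (Nat.primesBelow ⌈z⌉₊)
    (fun p hp => Nat.prime_of_mem_primesBelow hp)
  -- ratio of logarithms
  have hlogz : Real.log z = (1 / 10) * L := by rw [hz, Real.log_rpow hq0]
  have hlogN : Real.log ((N + 1 : ℕ) : ℝ) ≤ 5 * L := by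
    have h1 : ((N + 1 : ℕ) : ℝ) ≤ (q : ℝ) ^ 5 := by
      push_cast [hN]
      nlinarith [pow_le_pow_right₀ hq1 (show 1 ≤ 4 by norm_num), pow_pos hq0 4]
    calc Real.log ((N + 1 : ℕ) : ℝ) ≤ Real.log ((q : ℝ) ^ 5) := Real.log_le_log (by positivity) h1
      _ = 5 * L := by rw [Real.log_pow]; push_cast; ring
  have hlogN0 : 0 ≤ Real.log ((N + 1 : ℕ) : ℝ) := Real.log_nonneg (by linarith)
  have hratio : (Real.log ((N + 1 : ℕ) : ℝ) / Real.log z) ^ (2 : ℝ) ≤ 2500 := by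
    rw [Real.rpow_two]
    have hr : Real.log ((N + 1 : ℕ) : ℝ) / Real.log z ≤ 50 := by
      rw [hlogz, div_le_iff₀ (by positivity)]; linarith
    have hr0 : 0 ≤ Real.log ((N + 1 : ℕ) : ℝ) / Real.log z :=
      div_nonneg hlogN0 (by rw [hlogz]; positivity)
    nlinarith
  have hVW : Vz * W⁻¹ ≤ 2500 * K := by
    rw [← div_eq_mul_inv, div_le_iff₀ hW0]
    calc Vz ≤ K * (Real.log ((N + 1 : ℕ) : ℝ) / Real.log z) ^ (2 : ℝ) * W := hVV
      _ ≤ K * 2500 * W := by gcongr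
      _ = 2500 * K * W := by ring
  -- the `10/q` term against `1/(η log q)` via Siegel
  have h12 : 10 / (q : ℝ) ≤ 10 / C₀ * (1 / (η * L)) := by
    have hq14 : (q : ℝ)⁻¹ ≤ (q : ℝ) ^ (-(1 / 4) : ℝ) := by
      rw [← Real.rpow_neg_one]
      exact Real.rpow_le_rpow_of_exponent_le hq1 (by norm_num)
    calc 10 / (q : ℝ) = 10 / C₀ * (C₀ * (q : ℝ)⁻¹) := by field_simp
      _ ≤ 10 / C₀ * (C₀ * (q : ℝ) ^ (-(1 / 4) : ℝ)) := by gcongr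
      _ ≤ 10 / C₀ * (1 / (η * L)) := by gcongr
  -- assemble
  have hL1 : (χ.LFunction 1).re ≤ 1 / (η * L) * W⁻¹ + 10 / q := by linarith
  calc (χ.LFunction 1).re * Vz ≤ (1 / (η * L) * W⁻¹ + 10 / q) * Vz :=
        mul_le_mul_of_nonneg_right hL1 hVz3.1
    _ = 1 / (η * L) * (Vz * W⁻¹) + 10 / q * Vz := by ring
    _ ≤ 1 / (η * L) * (2500 * K) + 10 / q * 1 := by
        gcongr
        · exact hVz3.2.1
    _ ≤ 1 / (η * L) * (2500 * K) + 10 / C₀ * (1 / (η * L)) := by linarith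
    _ = (2500 * K + 10 / C₀) / (η * L) := by
        field_simp

/-! ### The discharge -/

/-- **Granville–Mollin 2000, §5C, the display preceding (5.5): PROVED.** For every `C > 9` there
are `K, η₀, d₀` such that for every negative fundamental `d ≡ 1 (mod 4)` with `|d| ≥ d₀`, every
real zero `β = 1 − 1/(η log|d|)` of `L(s, (d/·))` with `η ≥ η₀`, and every `x` with
`|d|^C ≤ x < |d|^η`: `∑_{p ≤ x} ω_{f_d}(p) log p ≤ K x log x / (η log|d|)` (here with `η₀ = 3`,
`d₀ = 1024`; the proof is the elementary sieve route described in the module docstring, not the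
explicit-formula argument of the source). [cite: GranvilleMollin2000, §5C (display before (5.5))] -/
theorem GranvilleMollin2000_eq5_5'_holds : GranvilleMollin2000_eq5_5' := by
  intro C hC
  obtain ⟨K₁, hK₁, hmain⟩ := exists_LOne_mul_prod_le
  obtain ⟨C₀, hC₀, hSiegel⟩ := Siegel.exists_one_sub_realZero_ge (ε := 1 / 4) (by norm_num)
  set Cfl : ℝ := SieveSequence.flConst 2 (4 * Real.exp (17 + 12 / Real.log 2)) with hCfl
  have hCfl0 : 0 < Cfl := SieveSequence.flConst_pos (by norm_num) (by positivity)
  refine ⟨4 / C₀ + (1 + Cfl) * K₁ + 5 / C₀, 3, 1024, ?_⟩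
  intro d hd hd₀ q _ hqd χ hprim hquad η hη hzero x hxC _hxη
  -- `|d| = q` as real numbers
  have hqR : |(d : ℝ)| = (q : ℝ) := by
    have h := congrArg (fun t : ℤ => (t : ℝ)) hqd
    simp only [Int.cast_natCast, Int.cast_abs] at h
    exact h.symm
  rw [hqR] at hd₀ hzero hxC
  rw [hqR]
  -- basic quantities
  have hq0 : (0 : ℝ) < q := by linarith
  have hq1 : (1 : ℝ) ≤ q := by linarith
  have hq2' : (2 : ℕ) ≤ q := by exact_mod_cast (show (2 : ℝ) ≤ q by linarith)
  have hχ1 : χ ≠ 1 := ne_one_of_isPrimitive hq2' hprim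
  have hχsq : χ ^ 2 = 1 := hquad.sq_eq_one
  have hlogq : 1 < Real.log q := by
    -- `log q > 1 ⟺ q > e` (as in `Literature.NumberTheory.Sieve.GreenTao2008.one_lt_log_of_three_le`)
    rw [Real.lt_log_iff_exp_lt hq0]
    have := Real.exp_one_lt_d9
    linarith
  set L := Real.log q with hL
  have hL0 : 0 < L := by linarith
  have hη0 : 0 < η := by linarith
  have hηL : 0 < η * L := by positivity
  -- Siegel: `η log q ≤ q^{1/4} / C₀`
  have hβform : (1 : ℝ) - (1 - 1 / (η * L)) = 1 / (η * L) := by ring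
  have hS := hSiegel q χ hχsq hχ1 (1 - 1 / (η * L)) hzero
  rw [hβform] at hS
  have hq4pos : 0 < (q : ℝ) ^ (1 / 4 : ℝ) := Real.rpow_pos_of_pos hq0 _
  have hηLle : η * L ≤ (q : ℝ) ^ (1 / 4 : ℝ) / C₀ := by
    have hqpow : (q : ℝ) ^ (-(1 / 4) : ℝ) = ((q : ℝ) ^ (1 / 4 : ℝ))⁻¹ := Real.rpow_neg hq0.le _
    have h1 : C₀ ≤ 1 / (η * L) * (q : ℝ) ^ (1 / 4 : ℝ) := by
      have h := hS
      rw [hqpow, ← div_eq_mul_inv, div_le_iff₀ hq4pos] at h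
      exact h
    rw [le_div_iff₀ hC₀]
    calc η * L * C₀ ≤ η * L * (1 / (η * L) * (q : ℝ) ^ (1 / 4 : ℝ)) :=
          mul_le_mul_of_nonneg_left h1 hηL.le
      _ = (q : ℝ) ^ (1 / 4 : ℝ) := by field_simp
  -- `x`
  have hqC : 0 < (q : ℝ) ^ C := Real.rpow_pos_of_pos hq0 C
  have hx0 : 0 < x := lt_of_lt_of_le hqC hxC
  have hlogx : C * L ≤ Real.log x := by
    rw [hL, ← Real.log_rpow hq0]
    exact Real.log_le_log hqC hxC
  have hlogx0 : 0 < Real.log x := by nlinarith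
  have hsqrt : (q : ℝ) ^ (C / 2) ≤ Real.sqrt x := by
    have : (q : ℝ) ^ (C / 2) = Real.sqrt ((q : ℝ) ^ C) := by
      rw [Real.sqrt_eq_rpow, ← Real.rpow_mul hq0.le]
      ring_nf
    rw [this]
    exact Real.sqrt_le_sqrt hxC
  -- `z = q^{1/10}`
  set z : ℝ := (q : ℝ) ^ (1 / 10 : ℝ) with hz
  have hz2 : 2 ≤ z := two_le_rpow_tenth hd₀
  have hz0 : 0 < z := by linarith
  have hzq : z ≤ q := by
    rw [hz]
    calc (q : ℝ) ^ (1 / 10 : ℝ) ≤ (q : ℝ) ^ (1 : ℝ) := Real.rpow_le_rpow_of_exponent_le hq1 (by norm_num)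
      _ = q := Real.rpow_one _
  have hqx : (q : ℝ) ≤ x := by
    calc (q : ℝ) = (q : ℝ) ^ (1 : ℝ) := (Real.rpow_one _).symm
      _ ≤ (q : ℝ) ^ C := Real.rpow_le_rpow_of_exponent_le hq1 (by linarith)
      _ ≤ x := hxC
  have hzx : z ≤ x := hzq.trans hqx
  have hz3 : z ^ 3 = (q : ℝ) ^ (3 / 10 : ℝ) := by
    rw [hz, ← Real.rpow_natCast, ← Real.rpow_mul hq0.le]
    norm_num
  -- (3) the main term
  have hLV := hmain q hd₀ χ hχ1 hχsq η hη hzero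
  set Vz := ∏ p ∈ Nat.primesBelow ⌈z⌉₊, (1 - (p : ℝ)⁻¹) * (1 - reChar χ p / p) with hVz
  -- (4) the sieve
  have hsieve := Literature.NumberTheory.Sieve.sum_primes_one_add_reChar_le χ hχ1 hχsq hz2 hzx
  set Swin := ∑ p ∈ (Nat.primesLE ⌊x⌋₊).filter (fun p : ℕ => z ≤ (p : ℝ)), (1 + reChar χ p) with hSwin
  -- (4a) main term of the sieve
  have ha : (1 + Cfl) * ((χ.LFunction 1).re * x * Vz) ≤ (1 + Cfl) * K₁ * (x / (η * L)) := by
    have : (χ.LFunction 1).re * x * Vz = x * ((χ.LFunction 1).re * Vz) := by ring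
    rw [this, mul_assoc (1 + Cfl) K₁, show K₁ * (x / (η * L)) = x * (K₁ / (η * L)) by ring]
    exact mul_le_mul_of_nonneg_left (mul_le_mul_of_nonneg_left hLV hx0.le) (by linarith)
  -- (4b) remainder of the sieve: `5 q √x z³ ≤ (5/C₀) x/(η log q)`
  have hb : 5 * (q : ℝ) * Real.sqrt x * z ^ 3 ≤ 5 / C₀ * (x / (η * L)) := by
    rw [show 5 / C₀ * (x / (η * L)) = (5 / C₀ * x) / (η * L) by ring, le_div_iff₀ hηL]
    have hpow : (q : ℝ) * z ^ 3 * (q : ℝ) ^ (1 / 4 : ℝ) = (q : ℝ) ^ (31 / 20 : ℝ) := by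
      rw [hz3, show (31 / 20 : ℝ) = 1 + 3 / 10 + 1 / 4 by norm_num, Real.rpow_add hq0,
        Real.rpow_add hq0, Real.rpow_one]
    have h31 : (q : ℝ) ^ (31 / 20 : ℝ) ≤ Real.sqrt x :=
      le_trans (Real.rpow_le_rpow_of_exponent_le hq1 (by linarith)) hsqrt
    have hsx : 0 ≤ Real.sqrt x := Real.sqrt_nonneg x
    calc 5 * (q : ℝ) * Real.sqrt x * z ^ 3 * (η * L)
        ≤ 5 * (q : ℝ) * Real.sqrt x * z ^ 3 * ((q : ℝ) ^ (1 / 4 : ℝ) / C₀) := by gcongr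
      _ = 5 / C₀ * Real.sqrt x * ((q : ℝ) * z ^ 3 * (q : ℝ) ^ (1 / 4 : ℝ)) := by ring
      _ = 5 / C₀ * Real.sqrt x * (q : ℝ) ^ (31 / 20 : ℝ) := by rw [hpow]
      _ ≤ 5 / C₀ * Real.sqrt x * Real.sqrt x := by gcongr
      _ = 5 / C₀ * x := by rw [mul_assoc, Real.mul_self_sqrt hx0.le]
  -- (5a) the small primes `p < z`: at most `⌈z⌉ ≤ 2z` of them, each with `ω(p) ≤ 2`
  have hc : ∑ p ∈ (Nat.primesLE ⌊x⌋₊).filter (fun p : ℕ => ¬ z ≤ (p : ℝ)),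
      (Literature.NumberTheory.Sieve.polyRootCountMod ![rabinowitschPoly d] p : ℝ) ≤ 4 * z := by
    set T := (Nat.primesLE ⌊x⌋₊).filter (fun p : ℕ => ¬ z ≤ (p : ℝ)) with hT
    have hsub : T ⊆ Finset.range ⌈z⌉₊ := by
      intro p hp
      rw [hT, Finset.mem_filter, not_le] at hp
      exact Finset.mem_range.mpr (Nat.lt_ceil.mpr hp.2)
    have hcard : (#T : ℝ) ≤ 2 * z := by
      calc (#T : ℝ) ≤ #(Finset.range ⌈z⌉₊) := by exact_mod_cast Finset.card_le_card hsub
        _ = ⌈z⌉₊ := by rw [Finset.card_range]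
        _ ≤ z + 1 := (Nat.ceil_lt_add_one hz0.le).le
        _ ≤ 2 * z := by linarith
    calc ∑ p ∈ T, (Literature.NumberTheory.Sieve.polyRootCountMod ![rabinowitschPoly d] p : ℝ)
        ≤ ∑ _p ∈ T, (2 : ℝ) := Finset.sum_le_sum fun p hp => by
          rw [hT, Finset.mem_filter, Nat.mem_primesLE] at hp
          exact polyRootCountMod_real_le_two hd hqd hp.1.2
      _ = 2 * #T := by rw [Finset.sum_const, nsmul_eq_mul]; ring
      _ ≤ 2 * (2 * z) := by gcongr
      _ = 4 * z := by ring
  have hc' : 4 * z ≤ 4 / C₀ * (x / (η * L)) := by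
    rw [show 4 / C₀ * (x / (η * L)) = (4 / C₀ * x) / (η * L) by ring, le_div_iff₀ hηL]
    have hpow : z * (q : ℝ) ^ (1 / 4 : ℝ) = (q : ℝ) ^ (7 / 20 : ℝ) := by
      rw [hz, ← Real.rpow_add hq0]; norm_num
    have h7 : (q : ℝ) ^ (7 / 20 : ℝ) ≤ x :=
      le_trans (Real.rpow_le_rpow_of_exponent_le hq1 (by linarith)) hxC
    calc 4 * z * (η * L) ≤ 4 * z * ((q : ℝ) ^ (1 / 4 : ℝ) / C₀) := by gcongr
      _ = 4 / C₀ * (z * (q : ℝ) ^ (1 / 4 : ℝ)) := by ring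
      _ = 4 / C₀ * (q : ℝ) ^ (7 / 20 : ℝ) := by rw [hpow]
      _ ≤ 4 / C₀ * x := by gcongr
  -- (5b) the large primes `z ≤ p ≤ x` carry `ω(p) = 1 + χ(p)`
  have hd' : ∑ p ∈ (Nat.primesLE ⌊x⌋₊).filter (fun p : ℕ => z ≤ (p : ℝ)),
      (Literature.NumberTheory.Sieve.polyRootCountMod ![rabinowitschPoly d] p : ℝ) = Swin := by
    rw [hSwin]
    refine Finset.sum_congr rfl fun p hp => ?_
    rw [Finset.mem_filter, Nat.mem_primesLE] at hp
    exact polyRootCountMod_eq_one_add_reChar hd hqd χ hprim hquad hp.1.2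
  -- (5c) `log p ≤ log x` on the range
  have hsum : ∑ p ∈ Nat.primesLE ⌊x⌋₊,
      (Literature.NumberTheory.Sieve.polyRootCountMod ![rabinowitschPoly d] p : ℝ) * Real.log p ≤
      Real.log x * ∑ p ∈ Nat.primesLE ⌊x⌋₊,
        (Literature.NumberTheory.Sieve.polyRootCountMod ![rabinowitschPoly d] p : ℝ) := by
    rw [Finset.mul_sum]
    refine Finset.sum_le_sum fun p hp => ?_
    rw [Nat.mem_primesLE] at hp
    have hp0 : (0 : ℝ) < p := by exact_mod_cast hp.2.pos
    have hpx : (p : ℝ) ≤ x := le_trans (by exact_mod_cast hp.1) (Nat.floor_le hx0.le)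
    have hlogp : Real.log p ≤ Real.log x := Real.log_le_log hp0 hpx
    have hω0 : (0 : ℝ) ≤ (Literature.NumberTheory.Sieve.polyRootCountMod ![rabinowitschPoly d] p : ℝ) :=
      Nat.cast_nonneg _
    calc (Literature.NumberTheory.Sieve.polyRootCountMod ![rabinowitschPoly d] p : ℝ) * Real.log p
        ≤ (Literature.NumberTheory.Sieve.polyRootCountMod ![rabinowitschPoly d] p : ℝ) * Real.log x :=
          mul_le_mul_of_nonneg_left hlogp hω0
      _ = Real.log x * _ := mul_comm _ _
  -- assemble
  have htot : ∑ p ∈ Nat.primesLE ⌊x⌋₊,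
      (Literature.NumberTheory.Sieve.polyRootCountMod ![rabinowitschPoly d] p : ℝ) ≤
      (4 / C₀ + (1 + Cfl) * K₁ + 5 / C₀) * (x / (η * L)) := by
    rw [← Finset.sum_filter_add_sum_filter_not (Nat.primesLE ⌊x⌋₊) (fun p : ℕ => z ≤ (p : ℝ)), hd']
    have hS' : Swin ≤ (1 + Cfl) * K₁ * (x / (η * L)) + 5 / C₀ * (x / (η * L)) := by
      rw [hSwin]; linarith [hsieve, ha, hb]
    linarith [hc, hc', hS']
  have hK0 : 0 ≤ 4 / C₀ + (1 + Cfl) * K₁ + 5 / C₀ := by positivity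
  calc ∑ p ∈ Nat.primesLE ⌊x⌋₊,
        (Literature.NumberTheory.Sieve.polyRootCountMod ![rabinowitschPoly d] p : ℝ) * Real.log p
      ≤ Real.log x * ∑ p ∈ Nat.primesLE ⌊x⌋₊,
          (Literature.NumberTheory.Sieve.polyRootCountMod ![rabinowitschPoly d] p : ℝ) := hsum
    _ ≤ Real.log x * ((4 / C₀ + (1 + Cfl) * K₁ + 5 / C₀) * (x / (η * L))) :=
        mul_le_mul_of_nonneg_left htot hlogx0.le
    _ = (4 / C₀ + (1 + Cfl) * K₁ + 5 / C₀) * (x * Real.log x / (η * L)) := by ring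

end Literature.Barriers.Parity
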